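import Summits.BirchSwinnertonDyer.BirchSwinnertonDyer.Theorems.KatoDescentPotSupersingularReducibleKatoMemberNodes
import Summits.BirchSwinnertonDyer.BirchSwinnertonDyer.Theorems.ByReductionTypeAtTwoAdditiveKatoFineConjAReducible
import Literature.NumberTheory.EllipticCurves.Kato2004.MemberHullInputsTwoNoSplitTwist
import Summits.BirchSwinnertonDyer.BirchSwinnertonDyer.Theorems.ByReductionTypeAtTwoAdditiveReducibleKatoMember
import Summits.BirchSwinnertonDyer.BirchSwinnertonDyer.Theorems.ByReductionTypeAtTwoAdditivePotMultKatoHalf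
import Literature.NumberTheory.EllipticCurves.Kato2004.IwasawaCohomologyExistsProofs
import Literature.NumberTheory.EllipticCurves.Rank1Residual.GVParityTwistTransportProofs
import Summits.BirchSwinnertonDyer.Rank1Residual.O6.X3KatoMemberBound
import HarnessLib

/-!
# Crux `AdditiveRankZeroAtTwo` (K4 item 19098), `E[2]`-REDUCIBLE curves of the POTENTIALLY MULTIPLICATIVE block: KATO'S MEMBER
# BOUND AT `p = 2` under (NST′) «no split multiplicative twist by `−1` or `−2` at `2`» — twin of
# `ByReductionTypeAtTwoAdditiveReducibleKatoMember.lean` (GEN 10) with `0 ≤ ord₂ j` replaced by (NST′)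
# (seat `bsd-2adic-addL2x` GEN 13; `--supports` helper; theorems only)

HONEST FRAMING: closes nothing at the `∀`-level; nothing booked; BSD is not proved by any of this. The member bound rests on ONE
named transcription (`exists_memberHullInputs_two_of_noSplitTwistNegOneNegTwo`, this seat GEN 13 = GEN 10's `exists_memberHullInputs_two`
with the potentially-good hypothesis replaced by (NST′); R13 of its module docstring) plus PRINT by name (Lim@2, Ferrero–Washington,
Cassels, Cassels–Tate, GZK, modularity). The proofs below are GEN 10's, word for word, with `hj : 0 ≤ padicValRat 2 W.j` replaced by
`hnst : ∀ d, d = -1 ∨ d = -2 → ¬ (W.quadraticTwist d).HasSplitMultiplicativeReductionAtPrime 2` (the hypothesis is only FED to the fact).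

* §0 `memberHullInputs_two_of_noSplitTwist` — the new fact IMPLIES GEN 10's (potentially good ⟹ (NST′)); pure logic.
* §1 `katoMemberShaBound_two_of_memberHullInputs_two_NST` — T-X3K at `2` under (NST′): Kato's member `W' ∼ W` satisfies
  `ord₂ #Ш(W')[2^∞] + v₂ Tam(W') ≤ ord₂(L(W',1)/Ω(W')) + 3·ord₂ #W'(ℚ)_tors`.
* §2 `missingUpperBoundAt_two_of_katoMember_two_NST` — T-X3K♯ at `2` under (NST′): the member bound ⟹ `MissingUpperBoundAt W 2` for
  every such `W` of analytic rank `0` whose isogeny class has no point of order `4`·(odd) in its `2`-primary torsion and with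
  `ord₂ #Ш_an(W)` even.
* §3 `addPotMultNST_reducibleUpper_two_of_smallTorsion` — the block form on {pot-mult, (NST′), reducible} with the two side conditions.
  Census: 61 of the 463 potentially multiplicative X5@2 classes are (NST′) with reducible `E[2]`; with the irreducible doors of
  `…AdditivePotMultKatoHalf.lean` the Kato half now reaches the WHOLE (NST′) sub-block (255 classes) up to C2″'s two side conditions,
  and child C4″ `AdditivePotMultOverKAtTwo` is needed only on {`W^{(−1)}` or `W^{(−2)}` split} ∪ {side-condition failures}.

References: [Kato2004Asterisque] Thm. 12.4–12.6, (12.5.1), 13.10 (1), 13.13–13.14, 14.5, §14.8, §14.14–14.15, Prop. 14.16 (2);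
[SilvermanATAEC1994] V.5.3, Ex. 5.11; [Wuthrich2014] Lemma 12; [GreenbergLNM1716] Prop. 4.13; [Lim2017FineSelmer] Thm. 3.5;
[FerreroWashington1979]; [Cassels1965ArithmeticVIII]; [MilneADT2006] I.7.3; [SilvermanAEC2009] X.4.14; [Miller2011LMS] Def. 1.1.
-/

set_option autoImplicit false
set_option linter.dupNamespace false

noncomputable section

open scoped Classical

namespace Summit.BirchSwinnertonDyer.BirchSwinnertonDyer.Theorems.AddKatoTwo

open WeierstrassCurve Literature.NumberTheory.EllipticCurves
  Literature.NumberTheory.EllipticCurves.ModularForms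
  Literature.NumberTheory.EllipticCurves.Kato2004
  Literature.NumberTheory.EllipticCurves.IwasawaAlgebra
  Literature.NumberTheory.EllipticCurves.Rank1Residual
  Literature.NumberTheory.EllipticCurves.Rank1Residual.Typed
  Literature.NumberTheory.IwasawaTheory
  Summit.BirchSwinnertonDyer.Rank1Residual Summit.BirchSwinnertonDyer.Rank1Residual.Additive
  Summit.BirchSwinnertonDyer.Rank1Residual.X5.AddTwoL2

/-! ## §1 Kato's member bound at `p = 2` under (NST′) (the node T-X3K at `2`; GEN 10's proof word for word) -/

/-- **Kato's member bound at `p = 2` for REDUCIBLE `E[2]`** — granted modularity (`hmod`), the named fact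
`Kato2004.exists_memberHullInputs_two` (`hin`: Kato Thm. 12.4, 12.5 (1)–(3), 12.6 + 13.10 (1) + 13.14, §14.14,
14.5 (1)(2) and the rank-`0` count at `T = V_{ℤ₂}(f)(1)`), Lim 2017 Thm. 3.5 at `2` (`hLim2`) and
Ferrero–Washington (`hFW`) BY NAME: for `W/ℚ` globally minimal, non-CM, additive at `2` with NO split multiplicative twist by `−1` or `−2` at
`2` ((NST′); potentially good OR potentially multiplicative), `W[2]` reducible, `L(W,1) ≠ 0`, `Ш(W)` finite, Kato's member `W' ∼ W` is globally minimal with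
`Ш(W')` finite and `ord₂ #Ш(W')[2^∞] + v₂ Tam(W') ≤ ord₂(L(W',1)/Ω(W')) + 3·ord₂ #W'(ℚ)_tors`.
Statement (A) at `(W', 2)` is DISCHARGED (`conjA_two_of_not_irreducible`; `W'[2]` is reducible with
`W[2]`); `𝐇¹_Γ` exists by the tree theorem `nonempty_iwasawaH1Data_holds`; the rest is rkm's node proof at
`p = 2` with `existsUnique_lift_of_zetaBody_two`. Conditional on `hmod`, `hin`, `hLim2`, `hFW`.
[cite: Kato2004Asterisque, Thm. 12.6 (p. 222), Lemma 13.10 (1) (p. 230), 13.14 (p. 234), §14.14 and Lemma 14.15 (pp. 243–244), Prop. 14.16 (2) (p. 244), §14.8 (p. 238)]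
[cite: Lim2017FineSelmer, §3 Thm. 3.5] [cite: FerreroWashington1979, Theorem] -/
theorem katoMemberShaBound_two_of_memberHullInputs_two_NST (hmod : exists_isNewformOf)
    (hin : Kato2004.exists_memberHullInputs_two_of_noSplitTwistNegOneNegTwo)
    (hLim2 : Lim2017.thm35_at_two_fineSelmerDual_moduleFinite_of_classicalMuVanishes_of_le_divisionField_four)
    (hFW : ferreroWashington1979_classicalMuVanishes)
    (W : WeierstrassCurve ℚ) [W.IsElliptic] [W.IsGloballyMinimal] (hcm : ¬ W.HasCM)
    (hng : ¬ W.HasGoodReductionAtPrime 2) (hnm : ¬ W.HasMultiplicativeReductionAtPrime 2)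
    (hnst : ∀ d : ℚ, d = -1 ∨ d = -2 → ¬ (W.quadraticTwist d).HasSplitMultiplicativeReductionAtPrime 2)
    (hred : ¬ W.HasIrreducibleModPGaloisRep 2)
    (hL : W.entireLFunction 1 ≠ 0) (hfin : Finite W.sha) :
    ∃ (W' : WeierstrassCurve ℚ) (_ : W'.IsElliptic) (_ : W'.IsGloballyMinimal),
      IsIsogenous W W' ∧ Finite W'.sha ∧
      ∃ q : ℚ, W'.entireLFunction 1 / (W'.realPeriodRat : ℂ) = (q : ℂ) ∧
        (padicValNat 2 (Nat.card (AddCommGroup.primaryComponent W'.sha 2)) : ℤ) +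
            padicValNat 2 W'.tamagawaProduct ≤
          padicValRat 2 q + 3 * (padicValNat 2 W'.torsionOrder : ℤ) := by
  -- Kato's member `W'` and the fact's data at it
  obtain ⟨W', hE', hM', hiso, hrest⟩ := hin W hcm hng hnm hnst hred hL hfin
  haveI := hE'
  haveI := hM'
  haveI : ContinuousSMul ℤ_[2] (W'.tateModule 2) := TateModule.continuousSMul_padicInt
  haveI : Module.Free ℤ_[2] (W'.tateModule 2) := W'.module_free_tateModule_holds 2
  haveI : Module.Finite ℤ_[2] (W'.tateModule 2) := W'.module_finite_tateModule_holds 2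
  -- statement (A) at `(W', 2)`: `W'[2]` is reducible with `W[2]`; Lim@2 + Ferrero–Washington BY NAME
  have hred' : ¬ W'.HasIrreducibleModPGaloisRep 2 := not_hasIrreducibleModPGaloisRep_of_isIsogenous hiso hred
  have hA' := conjA_two_of_not_irreducible hLim2 hFW W' hred'
  -- a newform of `W` (modularity) and a family of complex embeddings of the cyclotomic fields
  haveI : NeZero (W.conductorNorm ℤ) := ⟨(W.conductorNorm_pos_holds).ne'⟩
  obtain ⟨f, hf⟩ := hmod W
  obtain ⟨κ', Λ', c, d, a, A, z, x, -, -, -, -, hbody, hpack⟩ :=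
    hrest hA' f hf (fun m => Classical.arbitrary _)
  -- the cyclotomic `ℤ₂`-tower with a topological generator (PROVED), the pinned `𝐇¹_Γ(T₂W')`, the lift `𝐲`
  obtain ⟨κ, hκ, γ, hγ, -⟩ := exists_isCyclotomic_isTopGenerator_isCyclotomicVariable_holds 2
  obtain ⟨I⟩ := nonempty_iwasawaH1Data_holds W' 2 κ γ hκ hγ
  obtain ⟨y, hy⟩ :=
    (IwasawaH1Data.existsUnique_lift_of_zetaBody_two W' hκ I f (fun m => Classical.arbitrary _)
      κ' Λ' c d a A z x hbody).exists
  -- the package at `(I, 𝐲)`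
  obtain ⟨K⟩ := hpack κ γ hκ hγ I y hy
  have hfin' : Finite W'.sha := (IsIsogenous.shaFinite_iff_shaFinite hiso).mp hfin
  haveI := K.finite_H
  haveI := K.torsionFree_H
  haveI := K.finite_F
  haveI := K.torsionFree_F
  haveI := K.finite_H2
  -- the divisibility for the hull at EVERY height-one prime: off `(2)` Thm. 12.5 (3), at `(2)` `μ = 0`
  have hdiv : ∀ 𝔮 : PrimeSpectrum (IwasawaAlgebra 2), 𝔮.asIdeal.height = 1 →
      Module.lengthAt (IwasawaAlgebra 2) K.H2 𝔮 ≤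
        Module.lengthAt (IwasawaAlgebra 2) (K.F ⧸ (IwasawaAlgebra 2) ∙ K.z) 𝔮 := by
    intro 𝔮 h𝔮
    by_cases hq : 𝔮.asIdeal = augIdealP 2
    · have hμ : (Module.lengthAt (IwasawaAlgebra 2) K.H2 𝔮).toNat = 0 := by
        rw [← muInvariant_eq_toNat_lengthAt 2 K.H2 𝔮 hq]; exact K.mu_H2
      have hfinl : Module.lengthAt (IwasawaAlgebra 2) K.H2 𝔮 ≠ ⊤ :=
        IwasawaAlgebra.lengthAt_ne_top_of_isTorsion K.H2 K.isTorsion_H2 𝔮 (le_of_eq h𝔮)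
      have h0' : Module.lengthAt (IwasawaAlgebra 2) K.H2 𝔮 = 0 := by
        rw [← ENat.coe_toNat hfinl, hμ]; rfl
      rw [h0']
      exact bot_le
    · exact K.divisibility_offP 𝔮 h𝔮 hq
  -- the hull descent with the multiplier (PROVED module theory over `ℤ₂⟦X⟧`)
  have hhull := valuation_add_padicValNat_coinvariants_le_of_hull_smul K.j K.j_injective
    K.finite_coker K.z K.z_ne_zero K.isTorsion_quotient K.isTorsion_H2 hdiv y K.lam
    K.lam_constantCoeff_ne_zero K.j_y K.ι K.π K.ι_injective K.π_surjective K.exact_ι_π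
    K.finite_coinvariants_H2 K.index_ne_zero
  -- the count; the multiplier and the `𝐇²` terms cancel
  obtain ⟨q, hq, hcount⟩ := K.count
  refine ⟨W', hE', hM', hiso, hfin', q, hq, ?_⟩
  have hhull' : ((PowerSeries.constantCoeff K.lam).valuation : ℤ) +
      (padicValNat 2 (Nat.card (coinvariants 2 K.H2)) : ℤ) ≤
      (padicValNat 2 (Nat.card (K.A ⧸ (IwasawaAlgebra 2) ∙ K.ι (Submodule.Quotient.mk y))) : ℤ) := by
    exact_mod_cast hhull
  linarith

/-! ## §2 The kernel route at `2` under (NST′): member bound ⟹ hU3 on the classes with small `2`-torsion (GEN 10's proof word for word) -/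

/-- **hU3 = `MissingUpperBoundAt W 2` on the `E[2]`-REDUCIBLE, additive-at-`2`, (NST′)
analytic-rank-`0` curves whose isogeny class has `2`-primary torsion of order exactly `2` on every
member and whose `ord₂ #Ш_an` is even** — granted `hmod`/`hrat` (modularity, both spellings),
`exists_memberHullInputs_two` (`hin`), Lim@2 (`hLim2`), Ferrero–Washington (`hFW`), Cassels' isogeny
invariance (`hCassels`), the Cassels–Tate pairing (`hCT`) and GZK (`hGZK`) BY NAME. Proof = the kernel
route `O6.x3PotGoodRankZeroUpperOfSmallClassTorsion_of_katoMember` at `p = 2`: at Kato's member `W' ∼ W`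
(§1; `L(W,1) ≠ 0` by modularity, `Ш(W)` finite by GZK) `ord₂ #Ш(W') ≤ ord₂ #Ш_an(W') + t(W')`
(`O6.exists_shaAn_le_add_torsion_of_katoCurrency`) with `t(W') ≤ 1` (no point of order `4` or two
independent points of order `2` in the class); Cassels transports the defect to `W`
(`TwistComparison.defectAgreeAt_of_isIsogenous`); `ord₂ #Ш(W)` is even (Cassels–Tate) and
`ord₂ #Ш_an(W)` is even (hypothesis), so the slack `≤ 1` is `≤ 0`. Conditional on the named facts;
nothing else assumed. [cite: Kato2004Asterisque, Prop. 14.16 (2) (p. 244)] [cite: Cassels1965ArithmeticVIII]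
[cite: MilneADT2006, Thm. I.7.3] [cite: SilvermanAEC2009, Thm. X.4.14] [cite: Miller2011LMS, Def. 1.1] -/
theorem missingUpperBoundAt_two_of_katoMember_two_NST (hmod : exists_isNewformOf)
    (hin : Kato2004.exists_memberHullInputs_two_of_noSplitTwistNegOneNegTwo)
    (hLim2 : Lim2017.thm35_at_two_fineSelmerDual_moduleFinite_of_classicalMuVanishes_of_le_divisionField_four)
    (hFW : ferreroWashington1979_classicalMuVanishes)
    (hCassels : bsdRHS_eq_of_isIsogenous) (hCT : exists_casselsTate_pairing (K := ℚ))
    (hGZK : rank_eq_analyticRank_of_analyticRank_le_one) (hrat : hasEntireLFunction_rat)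
    (W : WeierstrassCurve ℚ) [W.IsElliptic] [W.IsGloballyMinimal] (hcm : ¬ W.HasCM)
    (hng : ¬ W.HasGoodReductionAtPrime 2) (hnm : ¬ W.HasMultiplicativeReductionAtPrime 2)
    (hnst : ∀ d : ℚ, d = -1 ∨ d = -2 → ¬ (W.quadraticTwist d).HasSplitMultiplicativeReductionAtPrime 2)
    (hred : ¬ W.HasIrreducibleModPGaloisRep 2)
    (hr : W.analyticRank = 0)
    (hsmall : ∀ (W' : WeierstrassCurve ℚ) [W'.IsElliptic], IsIsogenous W W' → ¬ 2 ^ 2 ∣ W'.torsionOrder)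
    (heven : ∀ q : ℚ, shaAn W = (q : ℂ) → Even (padicValRat 2 q)) :
    MissingUpperBoundAt W 2 := by
  -- `L(W,1) ≠ 0` (modularity) and `Ш(W)` finite (GZK)
  have hL : W.entireLFunction 1 ≠ 0 := (W.analyticRank_eq_zero_iff_holds (hrat W)).mp hr
  have hr1 : W.analyticRank ≤ 1 := by rw [hr]; exact zero_le_one
  have hfinW : W.ShaFinite := (hGZK W hr1).2
  -- Kato's member `W'`
  obtain ⟨W', hE', hM', hiso, hfin', q, hq, hle⟩ :=
    katoMemberShaBound_two_of_memberHullInputs_two_NST hmod hin hLim2 hFW W hcm hng hnm hnst hred hL hfinW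
  haveI := hE'
  haveI := hM'
  have hfin'S : W'.ShaFinite := hfin'
  have hr' : W'.analyticRank = 0 := by rw [← analyticRank_eq_of_isIsogenous' hiso, hr]
  -- Miller currency at `W'`, with the torsion slack `t(W') ≤ 1`
  obtain ⟨q', hq', hW'⟩ := O6.exists_shaAn_le_add_torsion_of_katoCurrency hGZK hrat W' 2 hr' hfin' hq hle
  have ht1 : padicValNat 2 W'.torsionOrder ≤ 1 :=
    padicValNat_le_one_of_not_sq_dvd W'.torsionOrder_pos_holds.ne' (hsmall W' hiso)
  -- Cassels: transport the defect from `W'` to `W`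
  obtain ⟨r, r', hr0, hrW, hδ⟩ :=
    TwistComparison.defectAgreeAt_of_isIsogenous W' W 2 hCassels hrat hiso.symm_of_isElliptic hfin'S hq'
  have hrq : r = q' := by exact_mod_cast hr0.symm.trans hq'
  rw [hrq] at hδ
  -- parity at `W`
  have hsqW : IsSquare W.shaOrder := isSquare_shaOrder_of_casselsTate hCT W hfinW
  obtain ⟨a, ha⟩ := O6.even_padicValNat_of_isSquare (p := 2) hsqW (W.shaOrder_pos hfinW).ne'
  obtain ⟨b, hb⟩ := heven r' hrW
  refine ⟨r', hrW, ?_⟩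
  have ht1' : ((padicValNat 2 W'.torsionOrder : ℕ) : ℤ) ≤ 1 := by exact_mod_cast ht1
  have ha' : ((padicValNat 2 W.shaOrder : ℕ) : ℤ) = (a : ℤ) + (a : ℤ) := by exact_mod_cast ha
  omega

/-! ## §3 The block form on {pot-mult, (NST′), reducible} with the two side conditions -/

/-- **hU3 on the `E[2]`-REDUCIBLE potentially MULTIPLICATIVE curves satisfying (NST′), on the classes with small `2`-torsion and even
`ord₂ #Ш_an`** — keyed like child C2″ (`¬CM → r_an = 0 → Addv W 2 → ord₂ j < 0 → (NST′) → ¬ irreducible → side conditions →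
MissingUpperBoundAt W 2`), from `exists_memberHullInputs_two_of_noSplitTwistNegOneNegTwo` + PRINT BY NAME. No over-`K` object.
Conditional; nothing asserted. [cite: Kato2004Asterisque, Prop. 14.16 (2) (p. 244), (12.5.1) (p. 222), 13.13 (p. 233)]
[cite: Cassels1965ArithmeticVIII] [cite: SilvermanAEC2009, Thm. X.4.14] -/
theorem addPotMultNST_reducibleUpper_two_of_smallTorsion (hmod : exists_isNewformOf)
    (hin : Kato2004.exists_memberHullInputs_two_of_noSplitTwistNegOneNegTwo)
    (hLim2 : Lim2017.thm35_at_two_fineSelmerDual_moduleFinite_of_classicalMuVanishes_of_le_divisionField_four)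
    (hFW : ferreroWashington1979_classicalMuVanishes)
    (hCassels : bsdRHS_eq_of_isIsogenous) (hCT : exists_casselsTate_pairing (K := ℚ))
    (hGZK : rank_eq_analyticRank_of_analyticRank_le_one) (hrat : hasEntireLFunction_rat) :
    ∀ (W : WeierstrassCurve ℚ) [W.IsElliptic] [W.IsGloballyMinimal], ¬ W.HasCM → W.analyticRank = 0 →
      Addv W 2 → padicValRat 2 W.j < 0 →
      (∀ d : ℚ, d = -1 ∨ d = -2 → ¬ (W.quadraticTwist d).HasSplitMultiplicativeReductionAtPrime 2) →
      ¬ W.HasIrreducibleModPGaloisRep 2 →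
      (∀ (W' : WeierstrassCurve ℚ) [W'.IsElliptic], IsIsogenous W W' → ¬ 2 ^ 2 ∣ W'.torsionOrder) →
      (∀ q : ℚ, shaAn W = (q : ℂ) → Even (padicValRat 2 q)) →
      MissingUpperBoundAt W 2 := by
  intro W _ _ hcm hr hadd _ hnst hred hsmall heven
  haveI : Fact (Nat.Prime 2) := ⟨Nat.prime_two⟩
  exact missingUpperBoundAt_two_of_katoMember_two_NST hmod hin hLim2 hFW hCassels hCT hGZK hrat W hcm hadd.1 hadd.2
    hnst hred hr hsmall heven

/-! ## §0 (placed last to reuse GEN 10's door) The new fact implies GEN 10's -/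

/-- **`exists_memberHullInputs_two_of_noSplitTwistNegOneNegTwo` IMPLIES `exists_memberHullInputs_two`**: a potentially good curve
has no split multiplicative twist by `−1` or `−2` (`noSplitTwistNegOneNegTwo_of_padicValRat_j_nonneg`). Pure logic.
[cite: Kato2004Asterisque, Thm. 12.5 (3) and (12.5.1) (p. 222)] -/
theorem memberHullInputs_two_of_noSplitTwist (h : Kato2004.exists_memberHullInputs_two_of_noSplitTwistNegOneNegTwo) :
    Kato2004.exists_memberHullInputs_two := by
  intro W _ _ hcm hng hnm hj hred hL hfin
  exact h W hcm hng hnm (noSplitTwistNegOneNegTwo_of_padicValRat_j_nonneg W hj) hred hL hfin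

end Summit.BirchSwinnertonDyer.BirchSwinnertonDyer.Theorems.AddKatoTwo

end
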